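import Literature.Probability.LatticeModels.VillainSpinWaveDuality
import Literature.MathematicalPhysics.QuantumFieldTheory.CubicalCochainsBox
import HarnessLib

/-!
# Vorticity of integer edge fields on a cube with grounded boundary: the classes
# `ℤ^{E(□)} / dℤ^{□°}` of the Villain duality are labelled by (vorticity, shell part)

Support file (groundwork for the lower-bound clause) of the named fact
`Literature.Probability.LatticeModels.FrohlichSpencerVillainSpinWaveBound` (`VillainSpinWave.lean`;
Dario–Wu 2020 Prop. 1.1 after Fröhlich–Spencer 1982). The duality formula of
`VillainSpinWaveDuality.lean` writes the zero-boundary-condition two-point function of the cube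
`□ = box d (n+1)` as the spin-wave factor times an average over the classes
`ξ ∈ ℤ^{E(□)} / dℤ^{□°}` of INTEGER EDGE FIELDS `m` modulo gradients of interior configurations.
Fröhlich–Spencer's analysis of that average (FS82 §§3–5: a dilute gas of vortices) starts by
identifying the classes with VORTICITIES. This file provides that identification:

* `extE n m` — an edge field of the cube as a `1`-cochain on `ℤ^d` (zero off the cube), with
  `extE_gradZ_of_mem : extE (dℓ̄) = d₀ ℓ̄` on the cube (`LatticeForm.d₀` of `CubicalCochains`);
* `vort n m = d₁ (extE n m)` — the **vorticity** (plaquette circulations `m(x,i) + m(x+eᵢ,j) −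
  m(x+eⱼ,i) − m(x,j)`), additive, and `vort_gradZ_eq_zero` — gradients are vortex free on every
  plaquette of the cube (`d₁ ∘ d₀ = 0`);
* `shell_const` — **the boundary shell `box d (n+1) ∖ box d n` of the cube is connected through
  shell edges** for `d ≥ 2` (a function constant along shell edges is constant on the shell: raise the
  unpinned coordinates to `n+1` inside a face, `shell_move_up`/`shell_set_coords`, then the pinned
  one inside another face) — exactly the topological input `H⁰(∂□) = ℤ` that makes
  `H¹(□, ∂□; ℤ) = 0`;
* **`mem_range_gradZ_iff`** (`d ≥ 2`) — `m ∈ dℤ^{□°}` iff `vort m = 0` on every plaquette of the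
  cube AND `m = 0` on the shell edges (both end-points off the interior): (⇐) by the Poincaré lemma
  on the box (`LatticeForm.exists_d₀_eq_of_flat_on_box`, tree) `m = d₀ g`, and `g` is constant on the
  connected shell; **`quotient_mk_eq_iff`** — two edge fields lie in the same class iff they have the
  same vorticity and the same shell part. (The shell edges join two grounded vertices; in
  `dirichletVillainWeight` they carry `K`-independent constant factors, and the spin-wave flow
  `sourceFlow` vanishes on them, so the shell part of a class decouples from `vortexAngle`.)

Everything is PROVED; no named fact is introduced (`extE`, `vort` are data).

## References

* [FrohlichSpencerCMP1982] J. Fröhlich, T. Spencer, Comm. Math. Phys. 83 (1982) 411–454, §2.3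
  (Poincaré lemma, Lemma 1), §2.4 (2.21)–(2.22) (classes ↔ vorticities/fluxes), §3.
* [ForsstromLenellsViklund2022] M. P. Forsström, J. Lenells, F. Viklund, Ann. Inst. H. Poincaré
  Probab. Stat. 58 (2022), §2 Lemma 2.2 (the Poincaré lemma on boxes; via `CubicalCochainsBox`).
-/

noncomputable section

open Finset Function Set

namespace Literature.Probability.LatticeModels

namespace DirichletVillain

open Literature.MathematicalPhysics.QuantumFieldTheory
open Literature.MathematicalPhysics.QuantumFieldTheory.LatticeForm (e d₀ d₁ d₁_d₀)

variable {d : ℕ} {n : ℕ}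

/-! ### Boxes as order intervals; edges and plaquettes of the cube -/

/-- `box d m` is the order interval `[-m, m]` of `ℤ^d` (set form). [folklore] -/
theorem mem_box_iff_mem_Icc {m : ℕ} {x : Site d} :
    x ∈ box d m ↔ x ∈ Set.Icc (-(m : Site d)) (m : Site d) := by
  rw [mem_box, Set.mem_Icc, Pi.le_def, Pi.le_def]
  simp only [Pi.neg_apply, Pi.natCast_apply]
  exact ⟨fun h => ⟨fun i => (h i).1, fun i => (h i).2⟩, fun h i => ⟨h.1 i, h.2 i⟩⟩

/-- A site squeezed between two sites of a box lies in the box. [folklore] -/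
theorem mem_box_of_le_of_le {m : ℕ} {x y z : Site d} (hx : x ∈ box d m) (hz : z ∈ box d m)
    (hxy : x ≤ y) (hyz : y ≤ z) : y ∈ box d m := by
  rw [mem_box_iff_mem_Icc] at hx hz ⊢
  exact ⟨hx.1.trans hxy, hyz.trans hz.2⟩

/-- `x ≤ x + eᵢ`. [folklore] -/
theorem le_add_e (x : Site d) (i : Fin d) : x ≤ x + e i := by
  intro k
  simp only [Pi.add_apply]
  by_cases hk : k = i
  · subst hk; simp
  · simp [Pi.single_eq_of_ne hk]

/-- The four edges of a plaquette of the cube are edges of the cube: if `x` and `x + eᵢ + eⱼ` lie in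
`box d (n+1)` then `(x, i)`, `(x, j)`, `(x + eᵢ, j)`, `(x + eⱼ, i)` are in `cubeEdges d n`. [folklore] -/
theorem plaquette_edges_mem {x : Site d} {i j : Fin d} (hx : x ∈ box d (n + 1))
    (hxij : x + e i + e j ∈ box d (n + 1)) :
    (x, i) ∈ cubeEdges d n ∧ (x, j) ∈ cubeEdges d n ∧ (x + e i, j) ∈ cubeEdges d n ∧
      (x + e j, i) ∈ cubeEdges d n := by
  have h1 : x + e i ∈ box d (n + 1) :=
    mem_box_of_le_of_le hx hxij (le_add_e x i) (le_add_e (x + e i) j)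
  have h2 : x + e j ∈ box d (n + 1) :=
    mem_box_of_le_of_le hx hxij (le_add_e x j) (by rw [add_right_comm]; exact le_add_e (x + e j) i)
  refine ⟨mem_cubeEdges.2 ⟨hx, h1⟩, mem_cubeEdges.2 ⟨hx, h2⟩, mem_cubeEdges.2 ⟨h1, hxij⟩,
    mem_cubeEdges.2 ⟨h2, ?_⟩⟩
  rw [add_right_comm]; exact hxij

/-! ### Integer edge fields of the cube as `1`-cochains on `ℤ^d` -/

variable (n) in
/-- An edge field of the cube `box d (n+1)` as a `1`-cochain on `ℤ^d` (extended by `0`). [folklore] -/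
def extE {A : Type*} [Zero A] (m : EIdx d n → A) : Site d → Fin d → A :=
  fun x i => if h : (x, i) ∈ cubeEdges d n then m ⟨(x, i), h⟩ else 0

/-- `extE` on an edge of the cube. [folklore] -/
theorem extE_of_mem {A : Type*} [Zero A] (m : EIdx d n → A) {x : Site d} {i : Fin d}
    (h : (x, i) ∈ cubeEdges d n) : extE n m x i = m ⟨(x, i), h⟩ := by
  simp only [extE, h, dite_true]

/-- `extE` at an edge index. [folklore] -/
@[simp] theorem extE_apply {A : Type*} [Zero A] (m : EIdx d n → A) (e' : EIdx d n) :
    extE n m e'.1.1 e'.1.2 = m e' := by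
  rw [extE_of_mem m (by simp)]

/-- `extE` off the cube. [folklore] -/
theorem extE_of_not_mem {A : Type*} [Zero A] (m : EIdx d n → A) {x : Site d} {i : Fin d}
    (h : (x, i) ∉ cubeEdges d n) : extE n m x i = 0 := by
  simp only [extE, h, dite_false]

/-- `extE` is additive. [folklore] -/
theorem extE_sub (m m' : EIdx d n → ℤ) : extE n (m - m') = extE n m - extE n m' := by
  funext x i
  by_cases h : (x, i) ∈ cubeEdges d n
  · simp only [Pi.sub_apply, extE_of_mem _ h]
  · simp only [Pi.sub_apply, extE_of_not_mem _ h, sub_zero]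

/-- **A gradient field is the coboundary of the zero extension** on the edges of the cube:
`extE (dℓ̄) (x, i) = d₀ ℓ̄ (x, i)` for `(x, i) ∈ E(□)`. [folklore] -/
theorem extE_gradZ_of_mem (ℓ : SIdx d n → ℤ) {x : Site d} {i : Fin d} (h : (x, i) ∈ cubeEdges d n) :
    extE n (gradZ n ℓ) x i = d₀ (extZ n ℓ) x i := by
  rw [extE_of_mem _ h, gradZ_apply, LatticeForm.d₀]

/-! ### Vorticity -/

variable (n) in
/-- **The vorticity of an integer edge field of the cube**: the plaquette sums
`(d₁ m)(x; i, j) = m(x,i) + m(x+eᵢ,j) − m(x+eⱼ,i) − m(x,j)` of its `1`-cochain. Only the plaquettes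
of the cube (`x`, `x + eᵢ + eⱼ ∈ box d (n+1)`) are meaningful. [folklore] -/
def vort (m : EIdx d n → ℤ) : Site d → Fin d → Fin d → ℤ := d₁ (extE n m)

/-- Vorticity is additive. [folklore] -/
theorem vort_sub (m m' : EIdx d n → ℤ) : vort n (m - m') = vort n m - vort n m' := by
  rw [vort, vort, vort, extE_sub, LatticeForm.d₁_sub]

/-- Congruence for `d₁` on one plaquette. [folklore] -/
theorem d₁_congr_plaquette {A : Type*} [AddCommGroup A] {θ θ' : Site d → Fin d → A} {x : Site d}
    {i j : Fin d} (h1 : θ x i = θ' x i) (h2 : θ (x + e i) j = θ' (x + e i) j)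
    (h3 : θ (x + e j) i = θ' (x + e j) i) (h4 : θ x j = θ' x j) : d₁ θ x i j = d₁ θ' x i j := by
  simp only [LatticeForm.d₁, h1, h2, h3, h4]

/-- **Gradients are vortex free**: the vorticity of `dℓ̄` vanishes on every plaquette of the cube
(`d₁ ∘ d₀ = 0`). [folklore] -/
theorem vort_gradZ_eq_zero (ℓ : SIdx d n → ℤ) {x : Site d} {i j : Fin d} (hx : x ∈ box d (n + 1))
    (hxij : x + e i + e j ∈ box d (n + 1)) : vort n (gradZ n ℓ) x i j = 0 := by
  obtain ⟨h1, h2, h3, h4⟩ := plaquette_edges_mem (n := n) hx hxij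
  rw [vort, d₁_congr_plaquette (extE_gradZ_of_mem ℓ h1) (extE_gradZ_of_mem ℓ h3)
    (extE_gradZ_of_mem ℓ h4) (extE_gradZ_of_mem ℓ h2), d₁_d₀]
  rfl


/-! ### The grounded boundary of the cube is connected (`d ≥ 2`) -/

/-- A vertex of the cube off the interior has a coordinate `± (n+1)`. [folklore] -/
theorem exists_coord_eq_of_not_mem {x : Site d} (hx1 : x ∈ box d (n + 1)) (hx0 : x ∉ box d n) :
    ∃ p : Fin d, x p = (n : ℤ) + 1 ∨ x p = -((n : ℤ) + 1) := by
  have hub := mem_box.1 hx1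
  by_contra h
  push Not at h
  apply hx0
  rw [mem_box]
  intro j
  have h1 := hub j
  have h2 := h j
  push_cast at h1
  constructor <;> omega

/-- **Moving along one axis inside the boundary shell.** If `g` takes equal values at the
end-points of every edge of the cube with both end-points off the interior `box d n`, then for a
vertex `y` of the cube with a pinned coordinate `|y_p| = n + 1` and `j ≠ p`,
`g (y with y_j := n+1) = g y` (all intermediate points stay in the shell). [folklore] -/
theorem shell_move_up {A : Type*} {g : Site d → A}
    (hg : ∀ (x : Site d) (i : Fin d), (x, i) ∈ cubeEdges d n → x ∉ box d n → x + e i ∉ box d n →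
      g (x + e i) = g x)
    {p j : Fin d} (hpj : p ≠ j) :
    ∀ (k : ℕ) (y : Site d), y ∈ box d (n + 1) → (y p = (n : ℤ) + 1 ∨ y p = -((n : ℤ) + 1)) →
      ((n : ℤ) + 1 - y j).toNat = k → g (Function.update y j ((n : ℤ) + 1)) = g y := by
  intro k
  induction k with
  | zero =>
    intro y hy _ hk
    have hyj := (mem_box.1 hy j).2
    push_cast at hyj
    have : y j = (n : ℤ) + 1 := by omega
    rw [← this, Function.update_eq_self]
  | succ k ih =>
    intro y hy hp hk
    have hyb := mem_box.1 hy
    have hyj := hyb j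
    push_cast at hyj
    -- the next point along the axis
    have hy' : y + e j ∈ box d (n + 1) := by
      rw [mem_box]
      intro l
      by_cases hl : l = j
      · subst hl
        simp only [Pi.add_apply, Pi.single_eq_same]
        push_cast
        constructor <;> omega
      · have := hyb l
        simp only [Pi.add_apply, Pi.single_eq_of_ne hl, add_zero]
        exact this
    have hpe : (y + e j) p = y p := by
      simp only [Pi.add_apply, Pi.single_eq_of_ne hpj, add_zero]
    have hnot : ∀ z : Site d, (z p = (n : ℤ) + 1 ∨ z p = -((n : ℤ) + 1)) → z ∉ box d n := by
      intro z hz hzn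
      have := mem_box.1 hzn p
      omega
    have hstep : g (y + e j) = g y :=
      hg y j (mem_cubeEdges.2 ⟨hy, hy'⟩) (hnot y hp) (hnot (y + e j) (by rw [hpe]; exact hp))
    have hk' : ((n : ℤ) + 1 - (y + e j) j).toNat = k := by
      simp only [Pi.add_apply, Pi.single_eq_same]
      omega
    have hupd : Function.update (y + e j) j ((n : ℤ) + 1) = Function.update y j ((n : ℤ) + 1) := by
      funext l
      by_cases hl : l = j
      · subst hl; simp
      · simp [Function.update_of_ne hl, Pi.single_eq_of_ne hl]
    rw [← hupd, ih (y + e j) hy' (by rw [hpe]; exact hp) hk', hstep]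

/-- Setting a set `S` of coordinates to `n + 1`. [folklore] -/
theorem shell_set_coords {A : Type*} {g : Site d → A}
    (hg : ∀ (x : Site d) (i : Fin d), (x, i) ∈ cubeEdges d n → x ∉ box d n → x + e i ∉ box d n →
      g (x + e i) = g x)
    (p : Fin d) {y : Site d} (hy : y ∈ box d (n + 1)) (hp : y p = (n : ℤ) + 1 ∨ y p = -((n : ℤ) + 1)) :
    ∀ S : Finset (Fin d), p ∉ S →
      g (fun l => if l ∈ S then (n : ℤ) + 1 else y l) = g y := by
  classical
  intro S
  induction S using Finset.induction_on with
  | empty => intro _; simp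
  | insert j S hjS ih =>
    intro hpS
    have hpj : p ≠ j := fun h => hpS (h ▸ Finset.mem_insert_self j S)
    have hpS' : p ∉ S := fun h => hpS (Finset.mem_insert_of_mem h)
    set z : Site d := fun l => if l ∈ S then (n : ℤ) + 1 else y l with hz
    have hz_mem : z ∈ box d (n + 1) := by
      rw [mem_box] at hy ⊢
      intro l
      simp only [hz]
      split_ifs
      · push_cast; constructor <;> omega
      · exact hy l
    have hzp : z p = (n : ℤ) + 1 ∨ z p = -((n : ℤ) + 1) := by
      simp only [hz, if_neg hpS']; exact hp
    have hupd : (fun l => if l ∈ insert j S then (n : ℤ) + 1 else y l) =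
        Function.update z j ((n : ℤ) + 1) := by
      funext l
      by_cases hl : l = j
      · subst hl; simp
      · simp [Finset.mem_insert, hl, hz]
    rw [hupd, shell_move_up hg hpj _ z hz_mem hzp rfl, ih hpS']

/-- **The boundary shell of the cube is connected** (`d ≥ 2`): a function taking equal values at
the end-points of every shell edge (both end-points in `box d (n+1) ∖ box d n`) is constant on the
shell — every shell vertex is joined to the corner `(n+1, …, n+1)` by shell edges (raise the
unpinned coordinates to `n + 1` inside a face, then, if the pinned coordinate was `-(n+1)`, raise it
inside another face). [folklore] -/
theorem shell_const (hd : 2 ≤ d) {A : Type*} {g : Site d → A}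
    (hg : ∀ (x : Site d) (i : Fin d), (x, i) ∈ cubeEdges d n → x ∉ box d n → x + e i ∉ box d n →
      g (x + e i) = g x)
    {x : Site d} (hx1 : x ∈ box d (n + 1)) (hx0 : x ∉ box d n) :
    g x = g (fun _ => (n : ℤ) + 1) := by
  classical
  obtain ⟨p, hp⟩ := exists_coord_eq_of_not_mem hx1 hx0
  -- raise all coordinates `≠ p` to `n + 1`
  have h1 := shell_set_coords hg p hx1 hp (Finset.univ.erase p) (Finset.notMem_erase p _)
  set t : Site d := fun l => if l ∈ Finset.univ.erase p then (n : ℤ) + 1 else x l with ht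
  rw [← h1]
  rcases hp with hp | hp
  · -- `x_p = n + 1`: we are at the corner
    congr 1
    funext l
    simp only [ht, Finset.mem_erase, Finset.mem_univ, and_true]
    split_ifs with hl
    · rfl
    · push Not at hl; rw [hl, hp]
  · -- `x_p = -(n+1)`: use a second coordinate `q ≠ p` as the pin and raise `p`
    obtain ⟨q, hqp⟩ : ∃ q : Fin d, q ≠ p := by
      by_cases h0 : p = ⟨0, by omega⟩
      · exact ⟨⟨1, by omega⟩, fun h => by rw [h0] at h; exact absurd (congrArg Fin.val h) (by simp)⟩
      · exact ⟨⟨0, by omega⟩, fun h => h0 h.symm⟩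
    have ht_mem : t ∈ box d (n + 1) := by
      rw [mem_box] at hx1 ⊢
      intro l
      simp only [ht]
      split_ifs
      · push_cast; constructor <;> omega
      · exact hx1 l
    have htq : t q = (n : ℤ) + 1 ∨ t q = -((n : ℤ) + 1) := by
      left
      simp only [ht, Finset.mem_erase, Finset.mem_univ, and_true, if_pos hqp]
    have htp : t p = -((n : ℤ) + 1) := by
      simp only [ht, Finset.mem_erase, Finset.mem_univ, and_true, ne_eq, not_true_eq_false, if_false]
      exact hp
    have h2 := shell_move_up hg hqp _ t ht_mem htq rfl
    rw [← h2]
    congr 1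
    funext l
    by_cases hl : l = p
    · subst hl; simp
    · rw [Function.update_of_ne hl]
      simp only [ht, Finset.mem_erase, Finset.mem_univ, and_true, if_pos hl]

/-! ### The structure theorem: gradients = vortex-free fields vanishing on the shell edges -/

/-- **An integer edge field of the cube is a gradient `dℓ̄` of an interior configuration iff it is
vortex free on the cube and vanishes on the shell edges** (`d ≥ 2`). (⇒): `d₁ ∘ d₀ = 0` and
`ℓ̄ = 0` on the shell. (⇐): by the Poincaré lemma on the box
(`LatticeForm.exists_d₀_eq_of_flat_on_box`) the field is `d₀ g` on the cube; `g` is constant on the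
shell, which is connected (`shell_const`), say `≡ c`, and `ℓ = g − c` on the interior works.
This is `H¹(□, ∂□; ℤ) = 0` for the cube relative to its (connected) boundary. [folklore] -/
theorem mem_range_gradZ_iff (hd : 2 ≤ d) (m : EIdx d n → ℤ) :
    m ∈ (gradZ (d := d) n).range ↔
      (∀ (x : Site d) (i j : Fin d), x ∈ box d (n + 1) → x + e i + e j ∈ box d (n + 1) →
          vort n m x i j = 0) ∧
        ∀ e' : EIdx d n, e'.1.1 ∉ box d n → e'.1.1 + e e'.1.2 ∉ box d n → m e' = 0 := by
  constructor
  · rintro ⟨ℓ, rfl⟩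
    refine ⟨fun x i j hx hxij => vort_gradZ_eq_zero ℓ hx hxij, fun e' h1 h2 => ?_⟩
    rw [gradZ_apply, extZ_of_not_mem _ h2, extZ_of_not_mem _ h1, sub_zero]
  · rintro ⟨hflat, hshell⟩
    -- Poincaré lemma on the box `[-(n+1), n+1]^d`
    obtain ⟨g, hg⟩ := LatticeForm.exists_d₀_eq_of_flat_on_box (extE n m)
      (-((n + 1 : ℕ) : Site d)) ((n + 1 : ℕ) : Site d) (fun x i j hx hxij =>
        hflat x i j (mem_box_iff_mem_Icc.2 hx) (mem_box_iff_mem_Icc.2 hxij))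
    have hg' : ∀ (x : Site d) (i : Fin d), (x, i) ∈ cubeEdges d n → g (x + e i) - g x = extE n m x i :=
      fun x i h => hg x i (mem_box_iff_mem_Icc.1 (mem_cubeEdges.1 h).1)
        (mem_box_iff_mem_Icc.1 (mem_cubeEdges.1 h).2)
    -- `g` is constant on the shell
    have hgshell : ∀ (x : Site d) (i : Fin d), (x, i) ∈ cubeEdges d n → x ∉ box d n →
        x + e i ∉ box d n → g (x + e i) = g x := by
      intro x i h h1 h2
      have h3 := hg' x i h
      rw [extE_of_mem _ h, hshell ⟨(x, i), h⟩ h1 h2] at h3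
      exact sub_eq_zero.1 h3
    set c : ℤ := g (fun _ => (n : ℤ) + 1) with hc
    have hgc : ∀ y : Site d, y ∈ box d (n + 1) → y ∉ box d n → g y = c := fun y hy1 hy0 =>
      shell_const hd hgshell hy1 hy0
    -- the interior configuration
    refine ⟨fun a => g a - c, funext fun e' => ?_⟩
    have hext : ∀ y : Site d, y ∈ box d (n + 1) → extZ n (fun a : SIdx d n => g a - c) y = g y - c := by
      intro y hy
      by_cases hy0 : y ∈ box d n
      · rw [extZ_of_mem _ hy0]
      · rw [extZ_of_not_mem _ hy0, hgc y hy hy0, sub_self]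
    obtain ⟨h1, h2⟩ := mem_cubeEdges.1 e'.2
    rw [gradZ_apply, hext _ h2, hext _ h1, sub_sub_sub_cancel_right, hg' _ _ e'.2, extE_apply]

/-- **The vortex classes.** Two integer edge fields of the cube define the same class in
`ℤ^{E(□)} / dℤ^{□°}` (the index set of the vortex-gas sum of `VillainSpinWaveDuality`) iff they have
the same vorticity on every plaquette of the cube and agree on the shell edges (`d ≥ 2`).
[folklore] -/
theorem quotient_mk_eq_iff (hd : 2 ≤ d) (m m' : EIdx d n → ℤ) :
    (QuotientAddGroup.mk m : (EIdx d n → ℤ) ⧸ (gradZ (d := d) n).range) = QuotientAddGroup.mk m' ↔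
      (∀ (x : Site d) (i j : Fin d), x ∈ box d (n + 1) → x + e i + e j ∈ box d (n + 1) →
          vort n m x i j = vort n m' x i j) ∧
        ∀ e' : EIdx d n, e'.1.1 ∉ box d n → e'.1.1 + e e'.1.2 ∉ box d n → m e' = m' e' := by
  rw [QuotientAddGroup.eq, neg_add_eq_sub, mem_range_gradZ_iff hd]
  simp only [vort_sub, Pi.sub_apply, sub_eq_zero]
  exact ⟨fun ⟨h1, h2⟩ => ⟨fun x i j hx hxij => (h1 x i j hx hxij).symm, fun e' ha hb => (h2 e' ha hb).symm⟩,
    fun ⟨h1, h2⟩ => ⟨fun x i j hx hxij => (h1 x i j hx hxij).symm, fun e' ha hb => (h2 e' ha hb).symm⟩⟩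

end DirichletVillain

end Literature.Probability.LatticeModels
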